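import Summits.QuantumFields.YangMills.Theorems.BalabanUVNodesN15KingModelToronEffectiveRate
import Summits.QuantumFields.YangMills.Theorems.BalabanUVNodesN15KingModelToronEtaRate
import HarnessLib

/-!
# BalabanUVNodes ∕ N15 — THE KING-MODEL RUNG (PART Ͷ-m): PART Ͷ BY NAME, IV — «NE2's ANALOGUE DECIDED IN THE MODEL» AT A LIVE FLAT LINK FIELD: King's fine covariance η-rate (4.7), his
# effective Laplacian (4.5) and its rate Lemma 4.3 ∕ Prop. 3.10 (3.91), all at the momentum shifted by the holonomy, in one conjunction
# (Track A, DAG node N15 = NE2 «η-rates of the covariance pieces»; FAN-OUT v1.1 §N15 s3 «KING-MODEL RUNG … ⇒ NE2's analogue DECIDED in the model … + what the curved case adds»; count-neutral)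

HONEST FRAMING.  Count-neutral (cell `pub-ymgap`, seat `pub-ymgap-dag-n15-e` g44; `--supports stmt-QuantumFields-27247 --as helper` = K3ᴬ, KEY MAP v3).  King's scalar block-spin
model [King1986] on finite tori with the covariant block mean of the tree's B5 toron twins at a constant abelian (flat) link field; this file only CONJOINS PARTS Ͷ-j∕Ͷ-k∕Ͷ-l by name.
WHAT THE CURVED CASE ADDS, in one line: a flat connection with holonomy `e^{iθ}` moves every momentum of King's §4 by `θ∕ℓ` (`s′ = p′ + L^kφ`); King's (4.4)∕(4.5)∕(4.7)∕(3.91) hold VERBATIM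
at `s′` — the tree's theorems are momentum-parametric — and the one new spectral datum is the holonomy gap (PART Ͷ-d∕Ͷ-e).  NOT Bałaban's vector-field `G_k(U)` ∕ [Balaban1985BackgroundPropagators]
(3.42) (no curvature, no Landau projection); NOT a node discharge (N15 of record untouched); nothing continuum-YM ∕ ℝ⁴ ∕ OS ∕ Clay.

PRIOR TREE ART: Ͷ-j (`lapSymTw_eq_latticeSymbol`, `abs_inv_lapSymTw_sub_inv_continuum_le`, `abs_inv_holonomyGap_sub_inv_continuum_le`), Ͷ-k (`effLapTw_eq_inv`, `dft_effLapTw_apply_eq_DeltaEff`),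
Ͷ-l (`king_lemma43_toron`, `king_prop310_toron_uniform`, `toronEffSymbol`), `King1986` (`latticeSymbol`, `momSq`, `DeltaEff`, `aK`).  Dedup (rg at filing): basename 0 files; needle
`king_toron_effective_package` 0 tree files.  Locators: [King1986] (4.4)–(4.5) p.670, (4.7)–(4.10) p.671, Lemma 4.3 (4.18) p.672, Prop. 3.10 (3.91) p.669, (2.13)–(2.14) p.653;
[Balaban1985BackgroundPropagators] (3.19) p.393, (3.23) p.394; [Balaban1984PropagatorsI] (1.30)–(1.31) p.23; [tHooft1979Flux] NPB 153 (notion only).  0 `sorry`, 0 `def`.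
-/

noncomputable section

open scoped BigOperators ComplexConjugate Matrix.Norms.L2Operator
open Finset Matrix Complex

namespace Summit.QuantumFields.YangMills.BalabanUVNodes.N15KingModelRung.Toron

open Literature.MathematicalPhysics.QuantumFieldTheory.Balaban1983to89.B5Prop11Plancherel
open Literature.MathematicalPhysics.QuantumFieldTheory.Balaban1983to89.B5ToronOperators118 (QsOpTw)
open Literature.MathematicalPhysics.QuantumFieldTheory.Balaban1983to89.B5ToronMomentum161 (sOfTw twistOf)
open Literature.MathematicalPhysics.QuantumFieldTheory.King1986 (DeltaEff aK aK_pos momSq latticeSymbol)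

variable {d : ℕ} (M : Fin (d + 1) → ℕ) [hM : ∀ μ, NeZero (M μ)]

/-- ★★★ **PART Ͷ BY NAME, IV — NE2's ANALOGUE AT A TORON** (`L ≥ 2`, `k, n ≥ 1`, `a > 0`, `m² > 0`, `N = L^k` fine points per unit, `c = N²`, phases `φ`, `ω = e^{iφ}`; coarse mode `q`
with shifted momentum `s′ = p′(q) + Nφ` in the Brillouin zone and `≠ 0`; `a_k = aK a L k`, `Δ^{(k)}_ω = effLapTw N M a_k c m² ω`):
(1) THE FINE LAYER ((4.4)∕(4.7) at the shifted momentum): for every torus `K`, spacing `η ≠ 0`, phases `φ′` and mode `q′` with `p = (p′(q′)+φ′)∕η ≠ 0` in the zone,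
    `|lapSymTw K (η²)⁻¹ m² φ′ q′⁻¹ − (|p|²+m²)⁻¹| ≤ (π²∕48)η²`;
(2) THE BLOCK LAYER ((4.5) at `s′`): `Δ^{(k)}_ω = (a_k⁻¹·1 + Q^ωB_ω⁻¹Q^{ω*})⁻¹` and `(Δ^{(k)}_ω g)^(p′) = DeltaEff a_k L^k m² s′·ĝ(p′)`;
(3) ITS RATE (Lemma 4.3 ∕ (3.91) at `s′`): `|Δ^{(k)}_ω(p′) − Δ^{(k+n)}_{ω′}(p′)| ≤ a_k·2(a_n⁻¹ + π²∕48 + 1∕3)·L^{−2k}·Δ^{(k)}_ω(p′)` (same holonomy at both levels) and `0 < Δ^{(k)}_ω(p′) ≤ a_k ≤ a`.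
[cite: King1986, (4.4)-(4.5) p.670, (4.7) p.671, Lemma 4.3 (4.18) p.672, Prop. 3.10 (3.91) p.669; Balaban1985BackgroundPropagators, (3.19) p.393, (3.23) p.394] -/
theorem king_toron_effective_package {a : ℝ} (ha : 0 < a) {L k n : ℕ} (hL : 2 ≤ L) (hk : 1 ≤ k) (hn : 1 ≤ n) {m2 : ℝ} (hm : 0 < m2)
    (φ : Fin (d + 1) → ℝ) (q : Tor M) (hzone : ∀ μ, |sOfTw (L ^ k) M φ q μ| ≤ Real.pi) (hq0 : 0 < momSq (sOfTw (L ^ k) M φ q)) :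
    haveI : NeZero (L ^ k) := ⟨pow_ne_zero k (by omega)⟩
    -- (1) the fine layer: King's (4.7) at every shifted mode of any torus
    (∀ (K : Fin (d + 1) → ℕ) [∀ μ, NeZero (K μ)] {η : ℝ} (_ : η ≠ 0) (φ' : Fin (d + 1) → ℝ) (q' : Tor K),
        (∀ μ, |sOf K q' μ + φ' μ| ≤ Real.pi) → 0 < momSq (fun μ => (sOf K q' μ + φ' μ) / η) →
        |(lapSymTw K ((η ^ 2)⁻¹) m2 φ' q')⁻¹ - (momSq (fun μ => (sOf K q' μ + φ' μ) / η) + m2)⁻¹| ≤ Real.pi ^ 2 / 48 * η ^ 2)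
    -- (2) the block layer: Woodbury and King's (4.5) symbol at the shifted momentum
    ∧ effLapTw (L ^ k) M (aK a L k) (((L ^ k : ℕ) : ℝ) ^ 2) m2 (twistOf φ)
        = (((aK a L k : ℝ) : ℂ)⁻¹ • (1 : Matrix (Tor M) (Tor M) ℂ)
            + QsOpTw (L ^ k) M (twistOf φ) * (toronOp (fine (L ^ k) M) (((L ^ k : ℕ) : ℝ) ^ 2) m2 (twistOf φ))⁻¹ * kingQadjTw (L ^ k) M (twistOf φ))⁻¹
    ∧ (∀ g : Tor M → ℂ, (dft M *ᵥ (effLapTw (L ^ k) M (aK a L k) (((L ^ k : ℕ) : ℝ) ^ 2) m2 (twistOf φ) *ᵥ g)) q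
        = ((toronEffSymbol M a L k m2 φ q : ℝ) : ℂ) * (dft M *ᵥ g) q)
    -- (3) the rate: King's Lemma 4.3 ∕ Prop. 3.10 at the shifted momentum, and the uniform bound
    ∧ |toronEffSymbol M a L k m2 φ q - toronEffSymbol M a L (k + n) m2 (fun μ => φ μ / (L : ℝ) ^ n) q|
        ≤ aK a L k * (2 * (((aK a L n)⁻¹ + Real.pi ^ 2 / 48 + 1 / 3) * (((L ^ k : ℕ) : ℝ) ^ 2)⁻¹)) * toronEffSymbol M a L k m2 φ q
    ∧ (0 < toronEffSymbol M a L k m2 φ q ∧ toronEffSymbol M a L k m2 φ q ≤ aK a L k ∧ aK a L k ≤ a) := by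
  haveI : NeZero (L ^ k) := ⟨pow_ne_zero k (by omega)⟩
  have hL1 : (1 : ℝ) < L := by exact_mod_cast hL
  refine ⟨fun K _ η hη φ' q' hz hp => abs_inv_lapSymTw_sub_inv_continuum_le K hη hm.le φ' q' hz hp,
    effLapTw_eq_inv (L ^ k) M (aK_pos ha hL1 hk) (sq_nonneg _) hm (norm_twistOf_eq_one φ),
    fun g => toronEffSymbol_eq M ha hL hk hm φ g q hzone,
    king_lemma43_toron M ha hL hk hn hm.le φ q hzone hq0,
    king_prop310_toron_uniform M ha hL hk hm.le φ q hzone hq0⟩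

end Summit.QuantumFields.YangMills.BalabanUVNodes.N15KingModelRung.Toron

end
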